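import Literature.AlgebraicTopology.SingularHomology.CupProductSupports
import Mathlib.Algebra.Homology.HomologicalComplexAbelian
import Mathlib.Algebra.Homology.HomologySequence
import Mathlib.Algebra.Homology.ConcreteCategory
import HarnessLib

/-!
# Relative singular cochains `Cⁿ(X, A; M)` and the long exact cohomology sequence of a pair

A. Hatcher, *Algebraic Topology* (2002), §3.1, pp. 199–200: "we can view `Cⁿ(X, A; G)` as the
functions from singular `n`-simplices in `X` to `G` that vanish on simplices in `A`", the short
exact sequence `0 → Cⁿ(X, A; G) → Cⁿ(X; G) → Cⁿ(A; G) → 0` (exactness at `Cⁿ(A; G)`: every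
cochain of `A` "can be extended to" `X`, e.g. by zero) and the associated long exact sequence
`⋯ → Hⁿ(X, A; G) → Hⁿ(X; G) → Hⁿ(A; G) --δ--> Hⁿ⁺¹(X, A; G) → ⋯`, with the description of the
coboundary map: `δ[α] = [δα̃]` for any extension `α̃ ∈ Cⁿ(X; G)` of the cocycle `α ∈ Zⁿ(A; G)`.

For the tree's singular cochains (`singularCochainComplex R M X`, honest functions
`SingularSimplex X n → M`, `SingularCochains.lean`) and a subset `A ⊆ X` we define and prove:

* `relCochains R M A n ⊆ (SingularSimplex X n → M)`: the submodule of cochains vanishing on the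
  simplices with image in `A`; it is stable under `δ` (`d_mem_relCochains`);
* `relCochainComplex R M A`: the cochain complex `C^•(X, A; M)` and
  `relSingularCohomology R M X A n = Hⁿ(X, A; M)`; the inclusion
  `relCochainComplex.ι : C^•(X, A) ⟶ C^•(X)` and the restriction
  `ρ = (A ↪ X)^♯ : C^•(X) ⟶ C^•(A)`;
* `relShortComplex_shortExact`: `0 → C^•(X, A) → C^•(X) → C^•(A) → 0` is short exact
  (surjectivity by extension by zero, `CupProductSupports.lean`);
* the long exact sequence: the maps `relSingularCohomology.toAbsolute` (`Hⁿ(X, A) → Hⁿ(X)`),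
  the restriction `Hⁿ(X) → Hⁿ(A)` (the tree's `singularCohomology.map (A ↪ X)`), the connecting
  map `relSingularCohomology.δ i j : Hⁱ(A) → Hʲ(X, A)` (`i + 1 = j`), exactness at the three
  spots (`exact_toAbsolute_map`, `exact_map_δ`, `exact_δ_toAbsolute`), and the cochain formula
  `δ_π_eq` (`δ[α] = [δα̃]` for any lift `α̃`);
* `relSingularCohomology.π_eq_zero_iff`: a relative cocycle has zero class iff it is the
  coboundary of a relative cochain.

Everything is proved; no named facts. Deliberately NOT here: excision and homotopy invariance
for relative cochains, maps of pairs beyond what is needed, the relative cup product.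

## References

* A. Hatcher, *Algebraic Topology*, CUP 2002, §3.1, pp. 199–200. [Hatcher2002]
-/

noncomputable section

open CategoryTheory Limits

universe u v

namespace Literature.AlgebraicTopology.SingularHomology

variable (R : Type v) [CommRing R] (M : Type v) [AddCommGroup M] [Module R M]
variable {X Y : Type u} [TopologicalSpace X] [TopologicalSpace Y]

open singularCochainComplex

/-! ### Relative cochains -/

/-- **Relative cochains** `Cⁿ(X, A; M)`: the cochains of `X` vanishing on every singular simplex
with image in `A` (Hatcher 2002, §3.1, p. 199). [cite: Hatcher2002, §3.1 p. 199] -/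
def relCochains (A : Set X) (n : ℕ) : Submodule R (SingularSimplex X n → M) where
  carrier := {φ | ∀ σ : SingularSimplex X n, σ.range ⊆ A → φ σ = 0}
  zero_mem' := fun _ _ => rfl
  add_mem' := fun {φ ψ} hφ hψ σ hσ => by rw [Pi.add_apply, hφ σ hσ, hψ σ hσ, add_zero]
  smul_mem' := fun r {φ} hφ σ hσ => by rw [Pi.smul_apply, hφ σ hσ, smul_zero]

variable {R M}

/-- Membership in `Cⁿ(X, A; M)`. [cite: Hatcher2002, §3.1 p. 199] -/
lemma mem_relCochains {A : Set X} {n : ℕ} {φ : SingularSimplex X n → M} :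
    φ ∈ relCochains R M A n ↔ ∀ σ : SingularSimplex X n, σ.range ⊆ A → φ σ = 0 :=
  Iff.rfl

/-- `δ` preserves relative cochains (faces of a simplex in `A` lie in `A`; Hatcher 2002, §3.1,
p. 199: `Cⁿ(X, A; G)` is a subcomplex). [cite: Hatcher2002, §3.1 p. 199] -/
lemma d_mem_relCochains {A : Set X} {n : ℕ} {φ : SingularSimplex X n → M}
    (hφ : φ ∈ relCochains R M A n) :
    ((singularCochainComplex R M X).d n (n + 1) φ : SingularSimplex X (n + 1) → M) ∈
      relCochains R M A (n + 1) := by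
  intro σ hσ
  rw [singularCochainComplex.d_apply]
  exact Finset.sum_eq_zero fun i _ => by
    rw [hφ _ ((σ.range_face_subset i).trans hσ), smul_zero]

/-- Relative cochains in shape `d m n` (any `m`, `n`). [folklore] -/
lemma d_mem_relCochains' {A : Set X} (m n : ℕ) {φ : SingularSimplex X m → M}
    (hφ : φ ∈ relCochains R M A m) :
    ((singularCochainComplex R M X).d m n φ : SingularSimplex X n → M) ∈ relCochains R M A n := by
  by_cases h : m + 1 = n
  · subst h; exact d_mem_relCochains hφ
  · rw [(singularCochainComplex R M X).shape m n h]
    exact (relCochains R M A n).zero_mem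

variable (R M)

/-- The differential of `C^•(X, A; M)`: the restriction of `δ`. [cite: Hatcher2002, §3.1 p. 199] -/
def relCochains.d (A : Set X) (n : ℕ) : relCochains R M A n →ₗ[R] relCochains R M A (n + 1) :=
  ((singularCochainComplex R M X).d n (n + 1)).hom.restrict fun _ hφ => d_mem_relCochains hφ

/-- **The relative cochain complex** `C^•(X, A; M)` (Hatcher 2002, §3.1, p. 199). [cite: Hatcher2002, §3.1 p. 199] -/
abbrev relCochainComplex (A : Set X) : CochainComplex (ModuleCat.{max u v} R) ℕ :=
  CochainComplex.of (fun n => ModuleCat.of R (relCochains R M A n))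
    (fun n => ModuleCat.ofHom (relCochains.d R M A n)) fun n =>
      ModuleCat.hom_ext (LinearMap.ext fun φ => Subtype.ext (by
        change ((singularCochainComplex R M X).d n (n + 1) ≫
          (singularCochainComplex R M X).d (n + 1) (n + 1 + 1)) φ.1 =
            (0 : SingularSimplex X (n + 1 + 1) → M)
        rw [HomologicalComplex.d_comp_d]
        rfl))

namespace relCochainComplex

variable {R M} {A : Set X} {n : ℕ}

/-- The degree-`n` object of `C^•(X, A; M)` is the module of relative cochains. [folklore] -/
lemma X_eq (n : ℕ) : (relCochainComplex R M A).X n = ModuleCat.of R (relCochains R M A n) := rfl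

/-- The differential of `C^•(X, A; M)` is the restriction of `δ`. [cite: Hatcher2002, §3.1 p. 199] -/
lemma d_eq (n : ℕ) :
    (relCochainComplex R M A).d n (n + 1) = ModuleCat.ofHom (relCochains.d R M A n) :=
  CochainComplex.of_d (fun n => ModuleCat.of R (relCochains R M A n))
    (fun n => ModuleCat.ofHom (relCochains.d R M A n)) n

/-- The underlying cochain of a relative cochain. [folklore] -/
abbrev val (φ : (relCochainComplex R M A).X n) : SingularSimplex X n → M :=
  Subtype.val φ

/-- Relative cochains are determined by their underlying cochains. [folklore] -/
lemma val_injective : Function.Injective (val : (relCochainComplex R M A).X n → _) :=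
  Subtype.val_injective

/-- The underlying cochain of a relative cochain is a relative cochain. [folklore] -/
lemma val_mem (φ : (relCochainComplex R M A).X n) : val φ ∈ relCochains R M A n :=
  Subtype.property φ

/-- The differential of `C^•(X, A; M)` on elements is `δ`. [cite: Hatcher2002, §3.1 p. 199] -/
@[simp] lemma val_d (φ : (relCochainComplex R M A).X n) :
    val ((relCochainComplex R M A).d n (n + 1) φ) =
      (singularCochainComplex R M X).d n (n + 1) (val φ) := by
  rw [d_eq]
  rfl

/-- `val` of the differential in shape `d m n`. [folklore] -/
lemma val_d' (m n : ℕ) (φ : (relCochainComplex R M A).X m) :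
    val ((relCochainComplex R M A).d m n φ) = (singularCochainComplex R M X).d m n (val φ) := by
  by_cases h : m + 1 = n
  · subst h; exact val_d φ
  · rw [(relCochainComplex R M A).shape m n h, (singularCochainComplex R M X).shape m n h]
    rfl

/-- `val (φ + ψ) = val φ + val ψ`. [folklore] -/
@[simp] lemma val_add (φ ψ : (relCochainComplex R M A).X n) : val (φ + ψ) = val φ + val ψ := rfl

/-- `val 0 = 0`. [folklore] -/
@[simp] lemma val_zero : val (0 : (relCochainComplex R M A).X n) = 0 := rfl

/-- Build a relative cochain from a cochain vanishing on the simplices in `A`. [folklore] -/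
abbrev mk (φ : SingularSimplex X n → M) (hφ : φ ∈ relCochains R M A n) :
    (relCochainComplex R M A).X n :=
  Subtype.mk φ hφ

/-- `val (mk φ h) = φ`. [folklore] -/
@[simp] lemma val_mk (φ : SingularSimplex X n → M) (hφ : φ ∈ relCochains R M A n) :
    val (mk φ hφ) = φ := rfl

variable (R M A) in
/-- The inclusion `C^•(X, A; M) ⟶ C^•(X; M)` (Hatcher 2002, §3.1, p. 199). [cite: Hatcher2002, §3.1 p. 199] -/
def ι : relCochainComplex R M A ⟶ singularCochainComplex R M X where
  f n := ModuleCat.ofHom (relCochains R M A n).subtype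
  comm' i j hij := by
    change i + 1 = j at hij
    subst hij
    refine ModuleCat.hom_ext (LinearMap.ext fun φ => ?_)
    change (singularCochainComplex R M X).d i (i + 1) (val φ) =
      val ((relCochainComplex R M A).d i (i + 1) φ)
    exact (val_d φ).symm

/-- `ι` on elements is the underlying cochain. [folklore] -/
@[simp] lemma ι_f_apply (φ : (relCochainComplex R M A).X n) : (ι R M A).f n φ = val φ := rfl

/-- `ι` is injective in each degree. [folklore] -/
lemma ι_f_injective : Function.Injective ((ι R M A).f n) :=
  Subtype.val_injective

variable (R M A) in
/-- The restriction `C^•(X; M) ⟶ C^•(A; M)` along the inclusion `A ↪ X` (Hatcher 2002, §3.1,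
p. 199). [cite: Hatcher2002, §3.1 p. 199] -/
abbrev ρ : singularCochainComplex R M X ⟶ singularCochainComplex R M A :=
  singularCochainComplex.map R M (subsetIncl A)

/-- `ρ` kills relative cochains: a cochain vanishing on the simplices in `A` restricts to `0`.
[cite: Hatcher2002, §3.1 p. 199] -/
lemma ρ_f_apply_eq_zero_of_mem {φ : SingularSimplex X n → M} (hφ : φ ∈ relCochains R M A n) :
    (ρ R M A).f n φ = 0 := by
  refine funext fun τ ↦ ?_
  rw [singularCochainComplex.map_apply]
  exact hφ _ (SingularSimplex.range_map_val_subset A τ)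

/-- Conversely, a cochain restricting to `0` on `A` is a relative cochain. [cite: Hatcher2002, §3.1 p. 199] -/
lemma mem_relCochains_of_ρ_eq_zero {φ : SingularSimplex X n → M} (h : (ρ R M A).f n φ = 0) :
    φ ∈ relCochains R M A n := by
  intro σ hσ
  have := congrFun h (σ.codRestrict A hσ)
  rwa [singularCochainComplex.map_apply, SingularSimplex.codRestrict_map_val] at this

/-- `ρ` is surjective in each degree (extension by zero; Hatcher 2002, §3.1, p. 199: cochains of
`A` "can be extended to" `X`). [cite: Hatcher2002, §3.1 p. 199] -/
lemma ρ_f_surjective : Function.Surjective ((ρ R M A).f n) := by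
  intro α
  refine ⟨Function.extend (fun τ : SingularSimplex A n ↦ τ.map (subsetIncl A)) α 0, ?_⟩
  refine funext fun τ ↦ ?_
  rw [singularCochainComplex.map_apply]
  exact (SingularSimplex.map_injective (n := n) (f := subsetIncl A)
    Subtype.val_injective).extend_apply α 0 τ

end relCochainComplex

open relCochainComplex

/-- The short complex `C^•(X, A; M) → C^•(X; M) → C^•(A; M)` (Hatcher 2002, §3.1, p. 199). [cite: Hatcher2002, §3.1 p. 199] -/
def relShortComplex (A : Set X) : ShortComplex (CochainComplex (ModuleCat.{max u v} R) ℕ) :=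
  ShortComplex.mk (ι R M A) (ρ R M A)
    (HomologicalComplex.hom_ext _ _ fun n => ModuleCat.hom_ext (LinearMap.ext fun φ =>
      ρ_f_apply_eq_zero_of_mem (val_mem (A := A) (n := n) φ)))

/-- **`0 → C^•(X, A; M) → C^•(X; M) → C^•(A; M) → 0` is short exact** (Hatcher 2002, §3.1,
pp. 199–200). [cite: Hatcher2002, §3.1 pp. 199–200] -/
theorem relShortComplex_shortExact (A : Set X) : (relShortComplex R M A).ShortExact := by
  refine HomologicalComplex.shortExact_of_degreewise_shortExact _ fun n => ?_
  refine ShortComplex.ShortExact.mk' ?_ ?_ ?_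
  · rw [ShortComplex.moduleCat_exact_iff]
    intro φ hφ
    exact ⟨⟨φ, mem_relCochains_of_ρ_eq_zero hφ⟩, rfl⟩
  · exact (ModuleCat.mono_iff_injective _).2 ι_f_injective
  · exact (ModuleCat.epi_iff_surjective _).2 ρ_f_surjective

variable (X) in
/-- **Relative singular cohomology** `Hⁿ(X, A; M)`, the `n`-th cohomology of `C^•(X, A; M)`
(Hatcher 2002, §3.1, p. 199). [cite: Hatcher2002, §3.1 p. 199] -/
def relSingularCohomology (A : Set X) (n : ℕ) : ModuleCat.{max u v} R :=
  (relCochainComplex R M A).homology n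

namespace relSingularCohomology

variable {R M}

variable (R M X) in
/-- The class map `Zⁿ(X, A; M) → Hⁿ(X, A; M)`. [cite: Hatcher2002, §3.1 p. 199] -/
abbrev π (A : Set X) (n : ℕ) :
    (relCochainComplex R M A).cycles n ⟶ relSingularCohomology R M X A n :=
  (relCochainComplex R M A).homologyπ n

variable (R M X) in
/-- `Hⁿ(X, A; M) → Hⁿ(X; M)`, induced by the inclusion of relative cochains (Hatcher 2002, §3.1,
p. 200, the map `j^*`). [cite: Hatcher2002, §3.1 p. 200] -/
abbrev toAbsolute (A : Set X) (n : ℕ) : relSingularCohomology R M X A n ⟶ singularCohomology R M X n :=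
  HomologicalComplex.homologyMap (ι R M A) n

variable (R M X) in
/-- **The connecting homomorphism** `δ : Hⁱ(A; M) → Hʲ(X, A; M)`, `i + 1 = j`, of the pair
`(X, A)` (Hatcher 2002, §3.1, p. 200). [cite: Hatcher2002, §3.1 p. 200] -/
def δ (A : Set X) (i j : ℕ) (hij : i + 1 = j) :
    singularCohomology R M A i ⟶ relSingularCohomology R M X A j :=
  (relShortComplex_shortExact R M A).δ i j hij

/-- **Exactness at `Hⁿ(X; M)`**: `Hⁿ(X, A) → Hⁿ(X) → Hⁿ(A)` is exact (Hatcher 2002, §3.1,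
p. 200). [cite: Hatcher2002, §3.1 p. 200] -/
theorem exact_toAbsolute_map (A : Set X) (n : ℕ) :
    (ShortComplex.mk (toAbsolute R M X A n) (singularCohomology.map R M (subsetIncl A) n)
      (by
        change HomologicalComplex.homologyMap (relShortComplex R M A).f n ≫
          HomologicalComplex.homologyMap (relShortComplex R M A).g n = 0
        rw [← HomologicalComplex.homologyMap_comp, (relShortComplex R M A).zero,
          HomologicalComplex.homologyMap_zero])).Exact :=
  (relShortComplex_shortExact R M A).homology_exact₂ n

/-- **Exactness at `Hⁱ(A; M)`**: `Hⁱ(X) → Hⁱ(A) → Hʲ(X, A)` is exact (Hatcher 2002, §3.1,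
p. 200). [cite: Hatcher2002, §3.1 p. 200] -/
theorem exact_map_δ (A : Set X) (i j : ℕ) (hij : i + 1 = j) :
    (ShortComplex.mk (singularCohomology.map R M (subsetIncl A) i) (δ R M X A i j hij)
      ((relShortComplex_shortExact R M A).comp_δ i j hij)).Exact :=
  (relShortComplex_shortExact R M A).homology_exact₃ i j hij

/-- **Exactness at `Hʲ(X, A; M)`**: `Hⁱ(A) → Hʲ(X, A) → Hʲ(X)` is exact (Hatcher 2002, §3.1,
p. 200). [cite: Hatcher2002, §3.1 p. 200] -/
theorem exact_δ_toAbsolute (A : Set X) (i j : ℕ) (hij : i + 1 = j) :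
    (ShortComplex.mk (δ R M X A i j hij) (toAbsolute R M X A j)
      ((relShortComplex_shortExact R M A).δ_comp i j hij)).Exact :=
  (relShortComplex_shortExact R M A).homology_exact₁ i j hij

/-- **The coboundary map on representatives**: for a cocycle `α ∈ Zⁱ(A; M)` and ANY cochain
`β ∈ Cⁱ(X; M)` restricting to `α` on `A`, `δβ` is a relative cocycle and `δ[α] = [δβ]` in
`Hʲ(X, A; M)` (Hatcher 2002, §3.1, p. 200 with §2.1 p. 116, the definition of the connecting
homomorphism). [cite: Hatcher2002, §3.1 p. 200] -/
theorem δ_homologyCls {A : Set X} {i j : ℕ} (hij : i + 1 = j) (α : SingularSimplex A i → M)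
    (hα : (singularCochainComplex R M A).d i ((ComplexShape.up ℕ).next i) α = 0)
    (β : SingularSimplex X i → M) (hβ : (ρ R M A).f i β = α)
    (hdβ : ((singularCochainComplex R M X).d i j β : SingularSimplex X j → M) ∈ relCochains R M A j)
    (hd : (relCochainComplex R M A).d j ((ComplexShape.up ℕ).next j)
      (mk ((singularCochainComplex R M X).d i j β) hdβ) = 0) :
    δ R M X A i j hij (homologyCls α hα) =
      homologyCls (K := relCochainComplex R M A)
        (mk ((singularCochainComplex R M X).d i j β) hdβ) hd := by
  have hα' : (singularCochainComplex R M A).d i j α = 0 := by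
    rw [← (ComplexShape.up ℕ).next_eq' hij]; exact hα
  have key := (relShortComplex_shortExact R M A).δ_apply i j hij α hα' β hβ
    (mk ((singularCochainComplex R M X).d i j β) hdβ) rfl ((ComplexShape.up ℕ).next j) rfl
  rw [δ, homologyCls_eq_homologyπ_cyclesMk _ hα j ((ComplexShape.up ℕ).next_eq' hij),
    homologyCls_eq_homologyπ_cyclesMk _ hd ((ComplexShape.up ℕ).next j) rfl]
  exact key

/-- The relative coboundary `δβ` of a lift `β` of a cocycle of `A` is a relative cocycle.
[cite: Hatcher2002, §3.1 p. 200] -/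
lemma d_mk_d_eq_zero {A : Set X} {i j : ℕ} (β : SingularSimplex X i → M)
    (hdβ : ((singularCochainComplex R M X).d i j β : SingularSimplex X j → M) ∈ relCochains R M A j)
    (k : ℕ) :
    (relCochainComplex R M A).d j k (mk ((singularCochainComplex R M X).d i j β) hdβ) = 0 := by
  apply val_injective
  rw [val_d', val_mk, val_zero, ← ModuleCat.comp_apply, HomologicalComplex.d_comp_d]
  rfl

/-- **A relative cocycle with zero class is a relative coboundary**: `[z] = 0` in `Hⁿ(X, A; M)`
iff `z = δw` for a relative cochain `w` of the previous degree (Hatcher 2002, §3.1). [cite: Hatcher2002, §3.1 p. 199] -/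
lemma π_eq_zero_iff {A : Set X} {n : ℕ} (z : (relCochainComplex R M A).cycles n) :
    π R M X A n z = 0 ↔
      ∃ w : (relCochainComplex R M A).X ((ComplexShape.up ℕ).prev n),
        (relCochainComplex R M A).d _ n w = (relCochainComplex R M A).iCycles n z := by
  have hz : (relCochainComplex R M A).d n ((ComplexShape.up ℕ).next n)
      ((relCochainComplex R M A).iCycles n z) = 0 := by
    rw [← ModuleCat.comp_apply, HomologicalComplex.iCycles_d]; rfl
  have hz' : (relCochainComplex R M A).d n (n + 1)
      ((relCochainComplex R M A).iCycles n z) = 0 := by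
    rw [← ModuleCat.comp_apply, HomologicalComplex.iCycles_d]; rfl
  have e : π R M X A n z = homologyCls ((relCochainComplex R M A).iCycles n z) hz := by
    rw [homologyCls_eq_homologyπ_cyclesMk _ hz (n + 1) (by simp) hz']
    change _ = π R M X A n _
    congr 1
    apply (ModuleCat.mono_iff_injective ((relCochainComplex R M A).iCycles n)).1 inferInstance
    exact ((relCochainComplex R M A).i_cyclesMk _ (n + 1) (by simp) hz').symm
  rw [e]
  exact homologyCls_eq_zero_iff _ hz

end relSingularCohomology

end Literature.AlgebraicTopology.SingularHomology
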